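import Summits.ValiantsHypothesis.ValiantsHypothesis.Theorems.KPlusLogSqLawRealDiagonalLetterOne

/-!
# Route «KPlusLogSqLaw» — diagonal-letter normal form, SYMMETRIC version: one symmetric letter plus row-monomial symmetric letters

HONEST FRAMING.  Helper bookkeeping for the OPEN crux `WeakLifting` (stmt-ValiantsHypothesis-19561, route `KPlusLogSqLaw`, cell
`pub-symmetroid`; seat val-sym-lift-p4 g25, 2026-08-29), the symmetric companion of `…KPlusLogSqLawRealDiagonalLetterOne` (Conjecture B ⟺ B
for general pencils with one arbitrary letter and diagonal letters).  Nothing here asserts `WeakLifting`, `TropicalB`, Conjecture B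
(`KPlusLogSqLaw`), `MatrixDescartes` (stmt-ValiantsHypothesis-18050) or anything about VP ≠ VNP.

THE POINT.  The same-`K` doubling `[[0, E], [Eᵀ, 0]]` (`RealDoubling.SD0`, same distinct real zeros) of a DIAGONAL letter is a symmetric
ROW-MONOMIAL letter (every row has at most one non-zero entry: `SD0_rowMonomial`) — a «swap letter» supported on the fixed matching
`i ↔ i + N`.  Hence `realRootLawAt_of_symmRowMonomial`: SYMMETRIC real pencils of format `((m·K+m)+(m·K+m), K + 1)` whose letters of index
`≥ 1` are row-monomial bound the census row `RealRootLawAt m K`, and ★ `kPlusLogSqLaw_iff_symmRowMonomial`: **Conjecture B ⟺ `∃ C`, every real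
SYMMETRIC lacunary pencil with ONE arbitrary symmetric letter and all other letters symmetric ROW-MONOMIAL (diagonal or swap patterns) has at
most `2^(C (K + ⌊log₂ n⌋²))` distinct real zeros of its determinant** (`→` is restriction — no doubling arithmetic; `←` by
`genRootLawAt_of_diagLetterOne`, the doubling, the fat cone and `lin_size_exponent_le`).
[folklore] symmetric doubling of a companion linearisation.
-/

set_option linter.dupNamespace false
set_option autoImplicit false

namespace Summit.ValiantsHypothesis.ValiantsHypothesis.Theorems.KPlusLogSqLaw.RealStatic

open Summit.ValiantsHypothesis.ValiantsHypothesis.Theorems.LacunarySymmetroidMatrixDescartes (RealRootLawAt KPlusLogSqLaw)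
open Summit.ValiantsHypothesis.ValiantsHypothesis.Theorems.LacunarySymmetroidMatrixDescartes.Census
  (realRootLawAt_mono card_roots_le_of_mul)
open Summit.ValiantsHypothesis.ValiantsHypothesis.Theorems.LacunarySymmetroidMatrixDescartes.TropicalCensus (realRootLawAt_zero)
open Summit.ValiantsHypothesis.ValiantsHypothesis.Theorems.KPlusLogSqLaw.RealDoubling
  (GenRootLawAt SD0 BD0 SD0_isSymm card_roots_SD0 realRootLawAt_of_genRootLawAt)
open scoped BigOperators Matrix
open Polynomial

variable {m K : ℕ}

/-- the same-`K` doubling of a DIAGONAL letter is ROW-MONOMIAL (at most one non-zero entry per row). [folklore] -/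
theorem SD0_rowMonomial {n K' : ℕ} (E : Fin K' → Matrix (Fin n) (Fin n) ℝ) (l : Fin K')
    (hE : ∀ x y, x ≠ y → E l x y = 0) :
    ∀ x y y', SD0 E l x y ≠ 0 → SD0 E l x y' ≠ 0 → y = y' := by
  intro x y y' h₁ h₂
  simp only [SD0, BD0, Matrix.reindex_apply, Matrix.submatrix_apply] at h₁ h₂
  have key : finSumFinEquiv.symm y = finSumFinEquiv.symm y' := by
    rcases hx : finSumFinEquiv.symm x with i | i <;> rcases hy : finSumFinEquiv.symm y with j | j <;>
      rcases hy' : finSumFinEquiv.symm y' with j' | j' <;> rw [hx, hy] at h₁ <;> rw [hx, hy'] at h₂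
    · simp at h₁
    · simp at h₁
    · simp at h₂
    · simp only [Matrix.fromBlocks_apply₁₂] at h₁ h₂
      have hj : j = i := by by_contra h; exact h₁ (hE i j (Ne.symm h))
      have hj' : j' = i := by by_contra h; exact h₂ (hE i j' (Ne.symm h))
      rw [hj, hj']
    · simp only [Matrix.fromBlocks_apply₂₁, Matrix.transpose_apply] at h₁ h₂
      have hj : j = i := by by_contra h; exact h₁ (hE j i h)
      have hj' : j' = i := by by_contra h; exact h₂ (hE j' i h)
      rw [hj, hj']
    · simp at h₂
    · simp at h₁
    · simp at h₁
  exact finSumFinEquiv.symm.injective key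

/-- **one symmetric letter + row-monomial symmetric letters bound general rows**: if every SYMMETRIC real pencil of format
`((m·K+m)+(m·K+m), K + 1)` whose letters of index `≥ 1` are row-monomial has at most `B` distinct real zeros of its determinant, then so does
every general real pencil of format `(m, K)`. [folklore] -/
theorem genRootLawAt_of_symmRowMonomial {B : ℕ}
    (h : ∀ (d' : Fin (K + 1) → ℕ) (E : Fin (K + 1) → Matrix (Fin ((m * K + m) + (m * K + m))) (Fin ((m * K + m) + (m * K + m))) ℝ),
      (∀ l, (E l).IsSymm) →
      (∀ l : Fin (K + 1), 1 ≤ (l : ℕ) → ∀ x y y', E l x y ≠ 0 → E l x y' ≠ 0 → y = y') →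
      (Matrix.det (∑ l, ((Polynomial.X : Polynomial ℝ) ^ d' l) • (E l).map Polynomial.C)).roots.toFinset.card ≤ B) :
    GenRootLawAt m K B := by
  intro d S
  obtain ⟨d', E, hdiag, hdet⟩ := exists_diagLetterOne_det_eq (R := ℝ) d S
  have hbig := h d' (SD0 E) (SD0_isSymm E) (fun l hl => SD0_rowMonomial E l (hdiag l hl))
  rw [card_roots_SD0, hdet, mul_comm] at hbig
  exact ((card_roots_le_of_mul _ _ (mul_ne_zero (prod_X_pow_ne_zero d)
    (pow_ne_zero _ (pow_ne_zero _ Polynomial.X_ne_zero)))).1).trans hbig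

/-- the same transfer in census currency (`RealRootLawAt m K`). [folklore] -/
theorem realRootLawAt_of_symmRowMonomial {B : ℕ}
    (h : ∀ (d' : Fin (K + 1) → ℕ) (E : Fin (K + 1) → Matrix (Fin ((m * K + m) + (m * K + m))) (Fin ((m * K + m) + (m * K + m))) ℝ),
      (∀ l, (E l).IsSymm) →
      (∀ l : Fin (K + 1), 1 ≤ (l : ℕ) → ∀ x y y', E l x y ≠ 0 → E l x y' ≠ 0 → y = y') →
      (Matrix.det (∑ l, ((Polynomial.X : Polynomial ℝ) ^ d' l) • (E l).map Polynomial.C)).roots.toFinset.card ≤ B) :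
    RealRootLawAt m K B :=
  realRootLawAt_of_genRootLawAt (genRootLawAt_of_symmRowMonomial h)

/-- **Conjecture B ⟺ Conjecture B for SYMMETRIC pencils with ONE arbitrary symmetric letter and ROW-MONOMIAL symmetric letters otherwise.**
An EQUIVALENCE between OPEN statements; neither side is asserted. [folklore] -/
theorem kPlusLogSqLaw_iff_symmRowMonomial :
    KPlusLogSqLaw ↔ ∃ C : ℕ, ∀ (n K' : ℕ) (d : Fin K' → ℕ) (E : Fin K' → Matrix (Fin n) (Fin n) ℝ),
      (∀ l, (E l).IsSymm) → (∀ l : Fin K', 1 ≤ (l : ℕ) → ∀ x y y', E l x y ≠ 0 → E l x y' ≠ 0 → y = y') →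
      (Matrix.det (∑ l, ((Polynomial.X : Polynomial ℝ) ^ d l) • (E l).map Polynomial.C)).roots.toFinset.card
        ≤ 2 ^ (C * (K' + Nat.log 2 n ^ 2)) := by
  constructor
  · rintro ⟨C, hC⟩
    exact ⟨C, fun n K' d E hsy _ => hC n K' d E hsy⟩
  · rintro ⟨C, hC⟩
    refine ⟨16 * C + 2, fun m K => ?_⟩
    rcases Nat.eq_zero_or_pos K with rfl | hK
    · exact realRootLawAt_zero m _
    by_cases hmK : m ≤ K
    · refine realRootLawAt_mono ?_ (realRootLawAt_fatCone_zero m K hmK)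
      exact Nat.pow_le_pow_right two_pos (Nat.mul_le_mul_right _ (by omega))
    · have hKm : K + 1 ≤ m := by omega
      refine realRootLawAt_mono ?_ (realRootLawAt_of_symmRowMonomial fun d' E hsy hrm => hC _ _ d' E hsy hrm)
      exact Nat.pow_le_pow_right two_pos
        ((lin_size_exponent_le C m K hK hKm).trans (Nat.mul_le_mul_right _ (by omega)))

end Summit.ValiantsHypothesis.ValiantsHypothesis.Theorems.KPlusLogSqLaw.RealStatic
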